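import Summits.ValiantsHypothesis.ValiantsHypothesis.Theorems.ZeroOneTransfer.Negative.LowDegreeCofactor

/-!
# `ZeroOneTransfer` — negative lemma: COFACTORS LIVING ON FEW ROWS, AND PÓLYA MULTIPLIERS OF ANY
# DEGREE, DO NOT HELP

Crux `stmt-ValiantsHypothesis-5066` (`Theses.DivisionGap.ZeroOneTransfer`, route DivisionGap).
Standing disprover (cdisprove gen 2), `Cruxes/ZeroOneTransfer/Disproof.lean` §(E).  Sharpens the
gen-1 lemma `two_rpow_le_complexity_stPoly_mul` (`LowDegreeCofactor.lean`): there the degree of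
the cofactor bounded the number of rows its row-lexicographic initial form occupies; here the
row set is the hypothesis, so the degree may be arbitrary.

* `two_rpow_le_complexity_stPoly_mul_of_rows` — for every nonzero `h ∈ ℝ≥0[x]`, every base `B`
  and every row set `R` with `|R| + 60 ≤ N` carrying all variables of the top
  `rowWeight B`-component of `h`:  `2^{(N - |R|)/20} ≤ L_{ℝ≥0}(ST_N · h) + 1`.
* `rows_topComponent_linPow` — the top row-lexicographic component (base `2`) of the PÓLYA
  MULTIPLIER `(a + Σ_v x_v)^M` lives on ONE row (the last), for every `a ≥ 0` and every `M`.
* `two_rpow_le_complexity_stPoly_mul_linPow` — hence `2^{(N-1)/20} ≤ L(ST_N · (a + Σ x)^M) + 1`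
  for `N ≥ 61`, ALL `M` and all `a`: Pólya multipliers of any degree are useless for `ST`.
* `zeroOneTransfer_polya_false` — the natural strengthening of the crux restricting the
  cofactor to Pólya multipliers `(1 + Σ_i x_i)^M` (the only general-purpose positivity
  certificate, Pólya 1928; the denominators of FominGrigorievKoshevoy2014 §8) is FALSE, witness
  `ST` (0/1 coefficients, `VP_ℂ`).  So a proof of the crux needs cofactors whose initial forms
  spread over almost all rows (as FGK's star–mesh pivots do), not powers of a fixed linear form.
[folklore] [cite: JerrumSnir1982, §4.5 and §5.1]
-/

namespace Summit.ValiantsHypothesis.ValiantsHypothesis.Theorems.ZeroOneTransfer.Negative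

set_option linter.dupNamespace false

open Literature.Computability.AlgebraicComplexity Literature.Barriers.ValiantsHypothesis
open MvPolynomial Finset
open scoped NNReal

noncomputable section

variable {N : ℕ}

/-! ### Cofactors on few rows -/

/-- **A cofactor whose row-lexicographic initial form lives on the rows `R` buys at most `|R|`
rows of the spanning-tree polynomial**: `2^{(N - |R|)/20} ≤ L_{ℝ≥0}(ST_N · h) + 1` whenever
`|R| + 60 ≤ N`.  Same proof as `two_rpow_le_complexity_stPoly_mul` (initial form free, `killRows`,
Jerrum–Snir by support), with the row set as a hypothesis instead of the degree. [folklore] -/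
theorem two_rpow_le_complexity_stPoly_mul_of_rows {h : MvPolynomial (Fin N × Option (Fin N)) ℝ≥0}
    (hh : h ≠ 0) (B : ℕ) (R : Finset (Fin N))
    (hrows : ∀ d ∈ (topComponent (rowWeight B) h).support, ∀ v ∈ d.support, v.1 ∈ R)
    (hR : R.card + 60 ≤ N) :
    (2 : ℝ) ^ ((1 / 20 : ℝ) * (N - R.card : ℕ)) ≤ complexity (stPoly ℝ≥0 N * h) + 1 := by
  classical
  set W := rowWeight (N := N) (β := Option (Fin N)) B with hW
  set hs := topComponent W h with hhs
  have hne : hs ≠ 0 := topComponent_ne_zero _ hh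
  set M := Fintype.card {i : Fin N // i ∉ R} with hM
  have hMeq : M = N - R.card := by
    rw [hM, Fintype.card_subtype_compl, Fintype.card_fin, Fintype.card_coe]
  have hM60 : 60 ≤ M := by omega
  let e : {i : Fin N // i ∉ R} ≃ Fin M := Fintype.equivFin _
  -- (1) initial form
  have h1 : complexity (stPoly ℝ≥0 N * hs) ≤ complexity (stPoly ℝ≥0 N * h) := by
    have := complexity_topComponent_le W (stPoly ℝ≥0 N * h)
    rwa [topComponent_mul, topComponent_eq_self_of_isWeightedHomogeneous W
      (isWeightedHomogeneous_stPoly B)] at this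
  -- (2) projection
  set q := aeval (killRows R e) (stPoly ℝ≥0 N) with hq
  set η : ℝ≥0 := ∑ d ∈ hs.support, coeff d hs with hη
  have hη0 : η ≠ 0 := sum_coeff_ne_zero hne
  have h2 : complexity (q * C η) ≤ complexity (stPoly ℝ≥0 N * hs) := by
    have := complexity_le_of_isProjection (isProjection_killRows R e (stPoly ℝ≥0 N * hs))
    rwa [map_mul, aeval_killRows_eq_C R e hrows] at this
  -- (3) unscale
  have h3 : complexity q ≤ complexity (q * C η) + 1 := by
    have hqq : q = η⁻¹ • (q * C η) := by
      rw [mul_comm, smul_eq_C_mul, ← mul_assoc, ← C_mul, inv_mul_cancel₀ hη0, C_1, one_mul]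
    conv_lhs => rw [hqq]
    exact complexity_smul_le_holds _ _
  -- (4) Jerrum–Snir by support on `Fin M`
  have h4 : (2 : ℝ) ^ ((1 / 20 : ℝ) * M) ≤ complexity q :=
    two_rpow_le_complexity_of_support_eq hM60 (support_aeval_killRows_stPoly R e)
  rw [← hMeq]
  calc (2 : ℝ) ^ ((1 / 20 : ℝ) * (M : ℕ)) ≤ complexity q := h4
    _ ≤ (complexity (q * C η) : ℝ) + 1 := by exact_mod_cast h3
    _ ≤ (complexity (stPoly ℝ≥0 N * h) : ℝ) + 1 := by
        have h21 : (complexity (q * C η) : ℝ) ≤ complexity (stPoly ℝ≥0 N * h) := by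
          exact_mod_cast h2.trans h1
        linarith

/-! ### Pólya multipliers: the initial form of `(a + Σ x)^M` lives on the last row -/

section LinPow

variable {σ : Type*}

/-- Top components of powers. [folklore] -/
theorem topComponent_pow (w : σ → ℕ) (p : MvPolynomial σ ℝ≥0) (M : ℕ) :
    topComponent w (p ^ M) = topComponent w p ^ M := by
  induction M with
  | zero => rw [pow_zero, pow_zero]; exact topComponent_one w
  | succ M ih => rw [pow_succ, pow_succ, topComponent_mul, ih]

/-- Variables of a power come from variables of the base. [folklore] -/
theorem vars_of_mem_support_pow {p : MvPolynomial σ ℝ≥0} {P : σ → Prop}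
    (hp : ∀ d ∈ p.support, ∀ v ∈ d.support, P v) (M : ℕ) :
    ∀ d ∈ (p ^ M).support, ∀ v ∈ d.support, P v := by
  classical
  induction M with
  | zero =>
    intro d hd v hv
    rw [pow_zero] at hd
    have hd0 : d = 0 := by
      by_contra hne
      rw [mem_support_iff, coeff_one, if_neg (Ne.symm hne)] at hd
      exact hd rfl
    rw [hd0] at hv
    simp at hv
  | succ M ih =>
    intro d hd v hv
    rw [pow_succ] at hd
    obtain ⟨a, ha, b, hb, rfl⟩ := Finset.mem_add.1 (support_mul _ _ hd)
    have hv' : v ∈ a.support ∪ b.support := Finsupp.support_add hv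
    rcases Finset.mem_union.1 hv' with h | h
    · exact ih a ha v h
    · exact hp b hb v h

end LinPow

/-- The affine linear form `a + Σ_v x_v` in the variables of `ST_N`. [folklore] -/
def linForm (N : ℕ) (a : ℝ≥0) : MvPolynomial (Fin N × Option (Fin N)) ℝ≥0 :=
  C a + ∑ v : Fin N × Option (Fin N), X v

/-- The coefficient of a single variable in `a + Σ x` is `1`. [folklore] -/
theorem coeff_single_linForm (a : ℝ≥0) (v : Fin N × Option (Fin N)) :
    coeff (Finsupp.single v 1) (linForm N a) = 1 := by
  classical
  rw [linForm, coeff_add, coeff_C, if_neg (Finsupp.single_ne_zero.mpr one_ne_zero).symm,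
    zero_add, coeff_sum, Finset.sum_eq_single v]
  · exact coeff_X_same v
  · intro u _ huv
    rw [coeff_X, if_neg]
    exact fun h => huv (Finsupp.single_left_injective one_ne_zero h)
  · intro hv; exact absurd (Finset.mem_univ v) hv

/-- The support of `a + Σ x`: the constant monomial or single variables. [folklore] -/
theorem mem_support_linForm {a : ℝ≥0} {d : (Fin N × Option (Fin N)) →₀ ℕ}
    (hd : d ∈ (linForm N a).support) : d = 0 ∨ ∃ v, d = Finsupp.single v 1 := by
  classical
  rw [linForm] at hd
  rcases Finset.mem_union.1 (support_add hd) with h | h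
  · left
    have hsub : (C a : MvPolynomial (Fin N × Option (Fin N)) ℝ≥0).support ⊆ {0} := by
      rw [support_C]; split_ifs <;> simp
    simpa using hsub h
  · right
    obtain ⟨v, _, hv⟩ := Finset.mem_biUnion.1 (support_sum h)
    refine ⟨v, ?_⟩
    have hsub : (X v : MvPolynomial (Fin N × Option (Fin N)) ℝ≥0).support ⊆
        {Finsupp.single v 1} := by
      rw [support_X]
    simpa using hsub hv

/-- **The row-lexicographic initial form of a Pólya multiplier lives on the last row.**  With
base `2`, every variable of every monomial of `top ((a + Σ x)^M)` lies in row `N - 1`.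
[folklore] -/
theorem rows_topComponent_linPow (hN : 1 ≤ N) (a : ℝ≥0) (M : ℕ) :
    ∀ d ∈ (topComponent (rowWeight 2) (linForm N a ^ M)).support, ∀ v ∈ d.support,
      v.1 ∈ ({⟨N - 1, by omega⟩} : Finset (Fin N)) := by
  classical
  rw [topComponent_pow]
  refine vars_of_mem_support_pow ?_ M
  intro d hd v hv
  rw [Finset.mem_singleton]
  set W := rowWeight (N := N) (β := Option (Fin N)) 2 with hW
  -- `d` has maximal weight and lies in the support of the linear form
  have hdp : d ∈ (linForm N a).support := support_topComponent_subset W _ hd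
  have hwt : Finsupp.weight W d = weightedTotalDegree W (linForm N a) := by
    have := mem_support_iff.mp hd
    rw [coeff_topComponent] at this
    by_contra hne
    exact this (if_neg hne)
  -- the maximal weight is at least `2^(N-1)`, attained by a variable of the last row
  set v₀ : Fin N × Option (Fin N) := (⟨N - 1, by omega⟩, none) with hv₀
  have hmax : (2 : ℕ) ^ (N - 1) ≤ weightedTotalDegree W (linForm N a) := by
    have hmem : Finsupp.single v₀ 1 ∈ (linForm N a).support := by
      rw [mem_support_iff, coeff_single_linForm]; exact one_ne_zero
    have := le_weightedTotalDegree W hmem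
    rwa [Finsupp.weight_single, smul_eq_mul, one_mul] at this
  rcases mem_support_linForm hdp with rfl | ⟨u, rfl⟩
  · -- the constant monomial has weight `0 < 2^(N-1)`
    rw [map_zero] at hwt
    rw [← hwt] at hmax
    exact absurd hmax (not_le.mpr (Nat.two_pow_pos _))
  · -- a single variable `u`: weight `2^{u.1} = max ≥ 2^(N-1)` forces `u.1 = N-1`
    rw [Finsupp.weight_single, smul_eq_mul, one_mul] at hwt
    have hle : (2 : ℕ) ^ (N - 1) ≤ 2 ^ (u.1 : ℕ) := by
      rw [← hwt] at hmax; exact hmax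
    have hu : N - 1 ≤ (u.1 : ℕ) := (Nat.pow_le_pow_iff_right (by norm_num)).mp hle
    have hv' : v = u := by
      rw [Finsupp.support_single _ one_ne_zero, Finset.mem_singleton] at hv
      exact hv
    rw [hv']
    ext
    have := u.1.isLt
    simp only
    omega

/-- The Pólya multiplier is nonzero. [folklore] -/
theorem linForm_pow_ne_zero (hN : 1 ≤ N) (a : ℝ≥0) (M : ℕ) : linForm N a ^ M ≠ 0 := by
  classical
  intro h0
  have h1 : eval (fun _ => (1 : ℝ≥0)) (linForm N a ^ M) = 0 := by rw [h0, map_zero]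
  rw [map_pow] at h1
  have hbase : eval (fun _ => (1 : ℝ≥0)) (linForm N a) ≠ 0 := by
    rw [linForm, map_add, eval_C, map_sum]
    simp only [eval_X, Finset.sum_const, Finset.card_univ, nsmul_eq_mul, mul_one]
    have hcard : (0 : ℝ≥0) < (Fintype.card (Fin N × Option (Fin N)) : ℝ≥0) := by
      have : 0 < Fintype.card (Fin N × Option (Fin N)) := by
        rw [Fintype.card_prod, Fintype.card_fin, Fintype.card_option, Fintype.card_fin]
        exact Nat.mul_pos (by omega) (by omega)
      exact_mod_cast this
    exact ne_of_gt (add_pos_of_nonneg_of_pos zero_le hcard)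
  exact pow_ne_zero M hbase h1

/-- **Pólya multipliers of any degree are useless for `ST`**: for `N ≥ 61`, every `a ≥ 0` and
EVERY exponent `M`, `2^{(N-1)/20} ≤ L_{ℝ≥0}(ST_N · (a + Σ_v x_v)^M) + 1`. [folklore] -/
theorem two_rpow_le_complexity_stPoly_mul_linPow (hN : 61 ≤ N) (a : ℝ≥0) (M : ℕ) :
    (2 : ℝ) ^ ((1 / 20 : ℝ) * (N - 1 : ℕ)) ≤ complexity (stPoly ℝ≥0 N * linForm N a ^ M) + 1 := by
  have h1 : 1 ≤ N := by omega
  have := two_rpow_le_complexity_stPoly_mul_of_rows (linForm_pow_ne_zero h1 a M) 2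
    {⟨N - 1, by omega⟩} (rows_topComponent_linPow h1 a M) (by simp; omega)
  simpa using this

/-! ### The Pólya strengthening of the crux is false -/

open Summit.ValiantsHypothesis.ValiantsHypothesis.Theses.DivisionGap (ZeroOneTransfer)

/-- **`ZeroOneTransfer` with PÓLYA cofactors is false.**  Restricting the cofactor of the crux
to powers `(1 + Σ_i x_i)^M` (any `M`, even uncharged degree) fails for `f = ST` (0/1 coefficients,
`VP_ℂ`): by `two_rpow_le_complexity_stPoly_mul_linPow`, `L(ST_N · (1 + Σ x)^M) + 1 ≥ 2^{(N-1)/20}`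
for all `M`, which beats `2^{(log₂ N + c)^c}` at the `N` of `exists_qp_lt_forty c`.  Pólya's
positivity certificates (multiply by a power of the sum of the variables) therefore cannot prove
the crux; cf. `zeroOneTransfer_lowDegreeCofactor_false` for all cofactors of degree `≤ deg f /2`.
[folklore] -/
theorem zeroOneTransfer_polya_false :
    ¬ (∀ (σ : ℕ → Type) [∀ n, Fintype (σ n)] (f : ∀ n, MvPolynomial (σ n) ℝ≥0),
        (∀ n m, MvPolynomial.coeff m (f n) = 0 ∨ MvPolynomial.coeff m (f n) = 1) →
        Literature.Computability.AlgebraicComplexity.IsVPFamily (k := ℂ)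
          (fun n => MvPolynomial.map (Complex.ofRealHom.comp NNReal.toRealHom) (f n)) →
        ∃ c : ℕ, ∀ n, ∃ M : ℕ,
          Literature.Computability.AlgebraicComplexity.complexity
              (f n * (1 + ∑ i : σ n, MvPolynomial.X i) ^ M) +
            Literature.Computability.AlgebraicComplexity.complexity
              ((1 + ∑ i : σ n, (MvPolynomial.X i : MvPolynomial (σ n) ℝ≥0)) ^ M) ≤
              2 ^ ((Nat.log 2 n + c) ^ c)) := by
  intro H
  have hmap : (fun N => map (Complex.ofRealHom.comp NNReal.toRealHom) (stPoly ℝ≥0 N)) =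
      fun N => stPoly ℂ N := by
    funext N; exact map_stPoly _ N
  have hVP : IsVPFamily (k := ℂ)
      (fun N => map (Complex.ofRealHom.comp NNReal.toRealHom) (stPoly ℝ≥0 N)) := by
    rw [hmap]; exact isVPFamily_stPoly_holds ℂ
  have h01 : ∀ (N : ℕ) (m : (Fin N × Option (Fin N)) →₀ ℕ),
      coeff m (stPoly ℝ≥0 N) = 0 ∨ coeff m (stPoly ℝ≥0 N) = 1 := by
    intro N m
    rw [coeff_stPoly]
    split_ifs <;> simp
  obtain ⟨c, hc⟩ := H (fun N => Fin N × Option (Fin N)) (fun N => stPoly ℝ≥0 N) h01 hVP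
  obtain ⟨N, hN, hle⟩ := exists_qp_lt_forty c
  obtain ⟨M, hbound⟩ := hc N
  have hlin : (1 + ∑ i : Fin N × Option (Fin N), (X i : MvPolynomial _ ℝ≥0)) = linForm N 1 := by
    rw [linForm, C_1]
  rw [hlin] at hbound
  have hlow := two_rpow_le_complexity_stPoly_mul_linPow (show 61 ≤ N by omega) 1 M
  generalize hE : (Nat.log 2 N + c) ^ c = E at hle hbound
  have hup : (complexity (stPoly ℝ≥0 N * linForm N 1 ^ M) : ℝ) + 1 ≤
      (2 : ℝ) ^ ((E + 1 : ℕ) : ℝ) := by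
    rw [Real.rpow_natCast]
    have : complexity (stPoly ℝ≥0 N * linForm N 1 ^ M) + 1 ≤ 2 ^ (E + 1) := by
      have := (Nat.le_add_right _ _).trans hbound
      have h1E : 1 ≤ 2 ^ E := Nat.one_le_two_pow
      rw [pow_succ]; omega
    exact_mod_cast this
  have h1 : (1 / 20 : ℝ) * (N - 1 : ℕ) ≤ ((E + 1 : ℕ) : ℝ) :=
    (Real.rpow_le_rpow_left_iff one_lt_two).mp (hlow.trans hup)
  have h2 : ((N - 1 : ℕ) : ℝ) ≤ 20 * ((E + 1 : ℕ) : ℝ) := by linarith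
  have h3 : N - 1 ≤ 20 * (E + 1) := by exact_mod_cast h2
  omega

end

end Summit.ValiantsHypothesis.ValiantsHypothesis.Theorems.ZeroOneTransfer.Negative
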